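import Literature.Geometry.Lorentzian.KIDJetRigidityProlongation
import HarnessLib

/-!
# Killing initial data are determined by their 1-jet at a point (chart-level unique continuation)

The conclusion of the one-jet rigidity of Killing initial data (generic prolongation with a source:
`KIDChartProlongation.lean`; KID-specific jet bound: `KIDJetRigidityProlongation.lean`; Moncrief
1975, §III; Beig–Chruściel 1997, §2). For vacuum data
`(G, K)` on an open preconnected set `V` of a finite-dimensional space (`MetricCoord.IsMetricOn G V`,
any signature, `dim ≠ 1`; `K` smooth symmetric; `H = 0`, `M = 0` on `V`) and a `C²` solution
`(N, X)` on `V` of the KID equations `DΦ*_{(G,K)}(N, X) = 0`: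

* `eventually_eq_zero_of_oneJet_eq_zero` — if `N`, `dN`, `X`, `DX` vanish at `x₀ ∈ V` they vanish
  near `x₀` (the 1-jet along segments solves a linear differential inequality by
  `exists_norm_jet_deriv_le`; Grönwall);
* **`eqOn_zero_of_isPreconnected`** — hence they vanish on all of `V` (open–closed argument): **a
  KID of vacuum data on a connected open set with vanishing 1-jet `(N, dN, X, DX)` at one point
  vanishes identically.** Consequently the KIDs on a connected open set inject into the
  finite-dimensional jet space at any point (Moncrief 1975, §III; Beig–Chruściel 1997, §2), which is
  the form in which the statement enters the "no KIDs on a sub-annulus" exhaustion of annular gluing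
  (`ParametricAnnulusGluingCore.lean`, hypothesis `(K)`).

The Killing case (`K = 0`, `N = 0`) is `KillingJetRigidity.eqOn_zero_of_isPreconnected`
(`KillingChartJetRigidity.lean`; O'Neill 1983, Ch. 9, Lemma 9.28). Everything is proved; no
definitions, no named facts.

## References

* V. Moncrief, J. Math. Phys. 16 (1975) 493–498, §III. [Moncrief1975]
* R. Beig, P. T. Chruściel, Class. Quantum Grav. 14 (1997) A83–A92, §2.
* B. O'Neill, *Semi-Riemannian geometry*, Academic Press 1983, Ch. 9, Lemma 9.28. [ONeill1983]
* S. Kobayashi, K. Nomizu, *Foundations of Differential Geometry* I, Wiley 1963, Ch. VI, Thm. 3.3.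
-/

noncomputable section

-- instance search through the nested operator types `E →L[ℝ] E →L[ℝ] E →L[ℝ] ℝ` (as in the tree files)
set_option maxSynthPendingDepth 3

open Set Filter Module Function Metric

open scoped ContDiff Topology

namespace Literature.Geometry.Lorentzian

namespace KIDJetRigidity

variable {E : Type*} [NormedAddCommGroup E] [NormedSpace ℝ E] [FiniteDimensional ℝ E]
  {G : E → E →L[ℝ] E →L[ℝ] ℝ} {X : E → E}

/-! ### Grönwall along segments and the open–closed argument -/

section Rigidity

variable [CompleteSpace E] {ι : Type*} [Fintype ι] (b : Basis ι ℝ E)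
  {K : E → E →L[ℝ] E →L[ℝ] ℝ} {V : Set E} {N : E → ℝ}

/-- **Local propagation of a vanishing 1-jet of a KID.** For vacuum data `(G, K)` on `V` and a
KID `(N, X)` of class `C²`: if `N`, `dN`, `X`, `DX` all vanish at `x₀ ∈ V`, they vanish on a
neighbourhood of `x₀` (the 1-jet `t ↦ (N, dN, X, DX)(x₀ + t v)` solves a linear differential
inequality `|y'| ≤ L |y|` along every short segment, by `exists_norm_jet_deriv_le`, so Grönwall's
inequality forces it to vanish). Moncrief 1975, §III ("determined by their values and first
derivatives at a point"); O'Neill 1983, Ch. 9, Lemma 9.28 for the Killing case.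
[cite: Moncrief1975, §III] -/
theorem eventually_eq_zero_of_oneJet_eq_zero (hG : MetricCoord.IsMetricOn G V)
    (hn : finrank ℝ E ≠ 1) (hK : ContDiffOn ℝ ∞ K V) (hKs : ∀ y ∈ V, ∀ v w, K y v w = K y w v)
    (hN : ContDiffOn ℝ 2 N V) (hX : ContDiffOn ℝ 2 X V)
    (hvac : ∀ y ∈ V, MetricCoord.hamAt G K y = 0 ∧ ∀ Z, MetricCoord.momFn b G K y Z = 0)
    (hkid : ∀ y ∈ V, MetricCoord.adjHamG G K N y + MetricCoord.adjMomGS G K X y = 0 ∧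
      MetricCoord.adjHamK G K N y + MetricCoord.adjMomKS G X y = 0)
    {x₀ : E} (hx₀ : x₀ ∈ V) (hN0 : N x₀ = 0) (hN1 : fderiv ℝ N x₀ = 0) (hX0 : X x₀ = 0)
    (hX1 : fderiv ℝ X x₀ = 0) :
    ∀ᶠ x in 𝓝 x₀, N x = 0 ∧ fderiv ℝ N x = 0 ∧ X x = 0 ∧ fderiv ℝ X x = 0 := by
  have hV : IsOpen V := hG.isOpen
  obtain ⟨C, hC0, hC⟩ := exists_norm_jet_deriv_le b hG hn hK hKs hN hX hvac hkid hx₀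
  obtain ⟨ρ, hρ, hball⟩ : ∃ ρ > 0, ball x₀ ρ ⊆
      {x | ‖fderiv ℝ (fderiv ℝ N) x‖ + ‖fderiv ℝ (fderiv ℝ X) x‖ ≤
        C * (|N x| + ‖fderiv ℝ N x‖ + ‖X x‖ + ‖fderiv ℝ X x‖)} ∩ V :=
    Metric.mem_nhds_iff.1 (Filter.inter_mem hC (hV.mem_nhds hx₀))
  refine Filter.eventually_of_mem (ball_mem_nhds x₀ hρ) fun x hx ↦ ?_
  -- the segment from `x₀` to `x` and the 1-jet along it
  set v : E := x - x₀ with hv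
  let γ : ℝ → E := fun t ↦ x₀ + t • v
  have hγd : ∀ t, HasDerivAt γ v t := fun t ↦ by
    have h := ((hasDerivAt_id t).smul_const v).const_add x₀
    rwa [one_smul] at h
  have hγball : ∀ t ∈ Icc (0 : ℝ) 1, γ t ∈ ball x₀ ρ := by
    intro t ht
    rw [mem_ball, dist_eq_norm]
    have hxv : ‖v‖ < ρ := by rwa [hv, ← dist_eq_norm, ← mem_ball]
    calc ‖γ t - x₀‖ = ‖t • v‖ := by simp [γ]
      _ = |t| * ‖v‖ := norm_smul t v
      _ ≤ 1 * ‖v‖ := by gcongr; rw [abs_le]; constructor <;> linarith [ht.1, ht.2]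
      _ < ρ := by rwa [one_mul]
  let Y : ℝ → (ℝ × (E →L[ℝ] ℝ)) × (E × (E →L[ℝ] E)) :=
    fun t ↦ ((N (γ t), fderiv ℝ N (γ t)), (X (γ t), fderiv ℝ X (γ t)))
  let Y' : ℝ → (ℝ × (E →L[ℝ] ℝ)) × (E × (E →L[ℝ] E)) :=
    fun t ↦ ((fderiv ℝ N (γ t) v, fderiv ℝ (fderiv ℝ N) (γ t) v),
      (fderiv ℝ X (γ t) v, fderiv ℝ (fderiv ℝ X) (γ t) v))
  have hY : ∀ t ∈ Icc (0 : ℝ) 1, HasDerivAt Y (Y' t) t := by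
    intro t ht
    have hts : V ∈ 𝓝 (γ t) := hV.mem_nhds (hball (hγball t ht)).2
    have h1 : HasDerivAt (fun t ↦ N (γ t)) (fderiv ℝ N (γ t) v) t :=
      ((hN.differentiableOn two_ne_zero).differentiableAt hts).hasFDerivAt.comp_hasDerivAt t (hγd t)
    have h2 : HasDerivAt (fun t ↦ fderiv ℝ N (γ t)) (fderiv ℝ (fderiv ℝ N) (γ t) v) t :=
      (((hN.fderiv_of_isOpen hV (m := 1) (by norm_num)).differentiableOn
        one_ne_zero).differentiableAt hts).hasFDerivAt.comp_hasDerivAt t (hγd t)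
    have h3 : HasDerivAt (fun t ↦ X (γ t)) (fderiv ℝ X (γ t) v) t :=
      ((hX.differentiableOn two_ne_zero).differentiableAt hts).hasFDerivAt.comp_hasDerivAt t (hγd t)
    have h4 : HasDerivAt (fun t ↦ fderiv ℝ X (γ t)) (fderiv ℝ (fderiv ℝ X) (γ t) v) t :=
      (((hX.fderiv_of_isOpen hV (m := 1) (by norm_num)).differentiableOn
        one_ne_zero).differentiableAt hts).hasFDerivAt.comp_hasDerivAt t (hγd t)
    exact (h1.prodMk h2).prodMk (h3.prodMk h4)
  have hYc : ContinuousOn Y (Icc 0 1) := fun t ht ↦ (hY t ht).continuousAt.continuousWithinAt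
  have hbound : ∀ t ∈ Ico (0 : ℝ) 1, ‖Y' t‖ ≤ (1 + 4 * C) * ‖v‖ * ‖Y t‖ + 0 := by
    intro t ht
    have ht' : t ∈ Icc (0 : ℝ) 1 := ⟨ht.1, ht.2.le⟩
    have hb := (hball (hγball t ht')).1
    simp only [mem_setOf_eq] at hb
    have n1 : |N (γ t)| ≤ ‖Y t‖ := by
      rw [← Real.norm_eq_abs]; exact (norm_fst_le _).trans (norm_fst_le (Y t))
    have n2 : ‖fderiv ℝ N (γ t)‖ ≤ ‖Y t‖ := (norm_snd_le _).trans (norm_fst_le (Y t))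
    have n3 : ‖X (γ t)‖ ≤ ‖Y t‖ := (norm_fst_le _).trans (norm_snd_le (Y t))
    have n4 : ‖fderiv ℝ X (γ t)‖ ≤ ‖Y t‖ := (norm_snd_le _).trans (norm_snd_le (Y t))
    have hvY : 0 ≤ ‖v‖ * ‖Y t‖ := by positivity
    have hJ4 : |N (γ t)| + ‖fderiv ℝ N (γ t)‖ + ‖X (γ t)‖ + ‖fderiv ℝ X (γ t)‖ ≤ 4 * ‖Y t‖ := by
      linarith
    have hDN : ‖fderiv ℝ (fderiv ℝ N) (γ t)‖ ≤ C * (4 * ‖Y t‖) :=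
      ((le_add_of_nonneg_right (norm_nonneg _)).trans hb).trans (by gcongr)
    have hDX : ‖fderiv ℝ (fderiv ℝ X) (γ t)‖ ≤ C * (4 * ‖Y t‖) :=
      ((le_add_of_nonneg_left (norm_nonneg _)).trans hb).trans (by gcongr)
    rw [add_zero, Prod.norm_def, Prod.norm_def, Prod.norm_def]
    have key1 : ‖Y t‖ * ‖v‖ ≤ (1 + 4 * C) * ‖v‖ * ‖Y t‖ := by
      linarith [mul_nonneg hC0 hvY]
    have key2 : C * (4 * ‖Y t‖) * ‖v‖ ≤ (1 + 4 * C) * ‖v‖ * ‖Y t‖ := by linarith [hvY]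
    refine max_le (max_le ?_ ?_) (max_le ?_ ?_)
    · calc ‖fderiv ℝ N (γ t) v‖ ≤ ‖fderiv ℝ N (γ t)‖ * ‖v‖ := ContinuousLinearMap.le_opNorm _ _
        _ ≤ ‖Y t‖ * ‖v‖ := by gcongr
        _ ≤ (1 + 4 * C) * ‖v‖ * ‖Y t‖ := key1
    · calc ‖fderiv ℝ (fderiv ℝ N) (γ t) v‖ ≤ ‖fderiv ℝ (fderiv ℝ N) (γ t)‖ * ‖v‖ :=
            ContinuousLinearMap.le_opNorm _ _
        _ ≤ C * (4 * ‖Y t‖) * ‖v‖ := by gcongr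
        _ ≤ (1 + 4 * C) * ‖v‖ * ‖Y t‖ := key2
    · calc ‖fderiv ℝ X (γ t) v‖ ≤ ‖fderiv ℝ X (γ t)‖ * ‖v‖ := ContinuousLinearMap.le_opNorm _ _
        _ ≤ ‖Y t‖ * ‖v‖ := by gcongr
        _ ≤ (1 + 4 * C) * ‖v‖ * ‖Y t‖ := key1
    · calc ‖fderiv ℝ (fderiv ℝ X) (γ t) v‖ ≤ ‖fderiv ℝ (fderiv ℝ X) (γ t)‖ * ‖v‖ :=
            ContinuousLinearMap.le_opNorm _ _
        _ ≤ C * (4 * ‖Y t‖) * ‖v‖ := by gcongr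
        _ ≤ (1 + 4 * C) * ‖v‖ * ‖Y t‖ := key2
  have hY0 : ‖Y 0‖ ≤ 0 := by simp [Y, γ, hN0, hN1, hX0, hX1]
  have hgr := norm_le_gronwallBound_of_norm_deriv_right_le hYc
    (fun t ht ↦ (hY t ⟨ht.1, ht.2.le⟩).hasDerivWithinAt) hY0 hbound 1 ⟨zero_le_one, le_rfl⟩
  rw [gronwallBound_ε0_δ0] at hgr
  have hY1 : Y 1 = 0 := norm_le_zero_iff.1 hgr
  have hγ1 : γ 1 = x := by simp [γ, hv]
  simp only [Y, hγ1, Prod.mk_eq_zero] at hY1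
  exact ⟨hY1.1.1, hY1.1.2, hY1.2.1, hY1.2.2⟩

/-- **Chart-level one-jet rigidity of Killing initial data.** Let `V ⊆ E` be open and
preconnected (`dim E ≠ 1`), `(G, K)` smooth vacuum data on `V` (`G` a metric of any signature, `K`
symmetric, `H = 0`, `M = 0`) and `(N, X)` a `C²` solution on `V` of the KID equations
`DΦ*_{(G,K)}(N, X) = 0`. If `N`, `dN`, `X`, `DX` vanish at ONE point `x₀ ∈ V`, then they vanish on
all of `V` (the vanishing set of the 1-jet is open by `eventually_eq_zero_of_oneJet_eq_zero` and
relatively closed by continuity). Consequently the KIDs of `(G, K)` on a connected open set are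
determined by their 1-jets `(N, dN, X, DX)` at any one point, and form a space of dimension at most
`1 + n + n + n² ` (Moncrief 1975, §III: the KIDs are the Cauchy data of the Killing fields of the
vacuum development, hence "determined by finitely many derivatives at a point"; Beig–Chruściel
1997, §2; the Killing case is O'Neill 1983, Ch. 9, Lemma 9.28). [cite: Moncrief1975, §III] -/
theorem eqOn_zero_of_isPreconnected (hG : MetricCoord.IsMetricOn G V) (hconn : IsPreconnected V)
    (hn : finrank ℝ E ≠ 1) (hK : ContDiffOn ℝ ∞ K V) (hKs : ∀ y ∈ V, ∀ v w, K y v w = K y w v)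
    (hN : ContDiffOn ℝ 2 N V) (hX : ContDiffOn ℝ 2 X V)
    (hvac : ∀ y ∈ V, MetricCoord.hamAt G K y = 0 ∧ ∀ Z, MetricCoord.momFn b G K y Z = 0)
    (hkid : ∀ y ∈ V, MetricCoord.adjHamG G K N y + MetricCoord.adjMomGS G K X y = 0 ∧
      MetricCoord.adjHamK G K N y + MetricCoord.adjMomKS G X y = 0)
    {x₀ : E} (hx₀ : x₀ ∈ V) (hN0 : N x₀ = 0) (hN1 : fderiv ℝ N x₀ = 0) (hX0 : X x₀ = 0)
    (hX1 : fderiv ℝ X x₀ = 0) :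
    ∀ x ∈ V, N x = 0 ∧ fderiv ℝ N x = 0 ∧ X x = 0 ∧ fderiv ℝ X x = 0 := by
  have hV : IsOpen V := hG.isOpen
  let Z : Set E := {x | ∀ᶠ y in 𝓝 x, N y = 0 ∧ fderiv ℝ N y = 0 ∧ X y = 0 ∧ fderiv ℝ X y = 0}
  have hZo : IsOpen Z := isOpen_setOf_eventually_nhds
  have hZ0 : x₀ ∈ Z :=
    eventually_eq_zero_of_oneJet_eq_zero b hG hn hK hKs hN hX hvac hkid hx₀ hN0 hN1 hX0 hX1
  have hNc : ContinuousOn N V := hN.continuousOn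
  have hN'c : ContinuousOn (fderiv ℝ N) V := hN.continuousOn_fderiv_of_isOpen hV (by norm_num)
  have hXc : ContinuousOn X V := hX.continuousOn
  have hX'c : ContinuousOn (fderiv ℝ X) V := hX.continuousOn_fderiv_of_isOpen hV (by norm_num)
  have hsub : V ⊆ Z := by
    refine hconn.subset_of_closure_inter_subset hZo ⟨x₀, hx₀, hZ0⟩ ?_
    rintro x ⟨hxc, hx⟩
    have hxs : V ∈ 𝓝 x := hV.mem_nhds hx
    -- the 1-jet vanishes at `x` by continuity
    have hfr : ∃ᶠ y in 𝓝 x, N y = 0 ∧ fderiv ℝ N y = 0 ∧ X y = 0 ∧ fderiv ℝ X y = 0 := by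
      rw [mem_closure_iff_frequently] at hxc
      exact hxc.mono fun y hy ↦ hy.self_of_nhds
    have hNx : N x = 0 :=
      tendsto_nhds_unique_of_frequently_eq ((hNc.continuousWithinAt hx).continuousAt hxs)
        tendsto_const_nhds (hfr.mono fun y hy ↦ hy.1)
    have hN'x : fderiv ℝ N x = 0 :=
      tendsto_nhds_unique_of_frequently_eq ((hN'c.continuousWithinAt hx).continuousAt hxs)
        tendsto_const_nhds (hfr.mono fun y hy ↦ hy.2.1)
    have hXx : X x = 0 :=
      tendsto_nhds_unique_of_frequently_eq ((hXc.continuousWithinAt hx).continuousAt hxs)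
        tendsto_const_nhds (hfr.mono fun y hy ↦ hy.2.2.1)
    have hX'x : fderiv ℝ X x = 0 :=
      tendsto_nhds_unique_of_frequently_eq ((hX'c.continuousWithinAt hx).continuousAt hxs)
        tendsto_const_nhds (hfr.mono fun y hy ↦ hy.2.2.2)
    exact eventually_eq_zero_of_oneJet_eq_zero b hG hn hK hKs hN hX hvac hkid hx hNx hN'x hXx hX'x
  intro x hx
  exact (hsub hx).self_of_nhds

end Rigidity

end KIDJetRigidity

end Literature.Geometry.Lorentzian

end
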